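import Literature.Geometry.Lorentzian.BogovskiiKernelCZ
import HarnessLib

/-!
# The frozen CZ kernel of `S_η`: base-point derivatives, the degree `−2` primitive, `C¹` off the origin

(trunk G08 = T-LORENTZ; family `gr`; namespace `Literature.Geometry.Lorentzian.MaoOhTao`.)

Complements to `BogovskiiKernelCZ` (Mao–Oh–Tao, arXiv:2308.13031, Lemma 2.3 (S3)), supplying exactly the hypotheses
of `Literature.Analysis.SingularIntegrals.eLpNorm_truncate_convolution_le` and of the diagonal-restriction device
(`Literature.Analysis.Calculus.exists_diag_lintegral_sq_le`) for the frozen kernel `K₂[η](z; y)`: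

* the ray transform is smooth in the base point with `∂_{y,v} Q_m[φ](z; y) = Q_m[∂_v φ](z; y)`
  (`hasFDerivAt_bogovskiiQ_base`, `fderiv_bogovskiiQ_base_apply`; derivatives in the base point fall on `φ` without
  changing the weight), whence `∂_{y_a} K₂[η] = K₂[∂_aη]` (`hasFDerivAt_bogovskiiK2_base`, using the symmetry of
  mixed partials `pd_pd_pd_rotate`) and `‖D_y K₂[η]‖ ≤ 3M(4D³ + 8D⁴ + 2D⁵)/|z|³` (`norm_fderiv_bogovskiiK2_base_le`);
* the primitive `∂_kΨ` (`K₂ = D(∂_kΨ) e_l`, `fderiv_pd_classicalKernel_apply_e`) is differentiable off the origin with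
  `|∂_kΨ| ≤ M(4D³ + 2D⁴)/|z|²` (`abs_pd_classicalKernel_le`) — the cancellation hypothesis;
* `K₂[η](·; y) ∈ C¹(ℝ³ ∖ 0)` for `η ∈ C⁴` (`contDiffOn_bogovskiiK2`).

## References

* Y. Mao, S.-J. Oh, T. Tao, arXiv:2308.13031 (2023), Lemma 2.3, pp. 8–9 (key `MaoOhTao2023`).
-/

noncomputable section

open scoped RealInnerProductSpace Topology
open Filter MeasureTheory Set Metric Function

namespace Literature.Geometry.Lorentzian

namespace MaoOhTao

variable {φ : E3 → ℝ} {R : ℝ}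

/-- Integrability of `s ↦ s^m Dφ(sz + y)` on `(1, ∞)` for `z ≠ 0` (compact `s`-support). [folklore] -/
theorem integrable_pow_smul_fderiv_ray' (hφ : ContDiff ℝ 1 φ) (hR : ∀ z : E3, R < ‖z‖ → φ z = 0) (y : E3) (m : ℕ)
    {z : E3} (hz : z ≠ 0) :
    Integrable (fun s : ℝ ↦ (s ^ m) • fderiv ℝ φ (s • z + y)) (volume.restrict (Ioi 1)) := by
  have hdc : Continuous (fderiv ℝ φ) := hφ.continuous_fderiv one_ne_zero
  set T : ℝ := max (R + ‖y‖) 0 / ‖z‖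
  have hc : Continuous fun s : ℝ ↦ (s ^ m) • fderiv ℝ φ (s • z + y) :=
    (continuous_pow m).smul (hdc.comp ((continuous_id.smul continuous_const).add continuous_const))
  refine (hc.integrable_of_hasCompactSupport (HasCompactSupport.intro (isCompact_Icc (a := -T) (b := T))
    fun s hs ↦ ?_)).restrict
  have hs' : T < |s| := by
    by_contra hle
    exact hs (abs_le.1 (not_lt.1 hle))
  show (s ^ m) • fderiv ℝ φ (s • z + y) = 0
  rw [fderiv_eta_ray_eq_zero hR (lt_abs_mul_norm_of_lt hz hs'), smul_zero]

/-- **`Q_m[φ](z; ·)` is differentiable in the base point, with derivative under the integral sign**: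
`D_y Q_m[φ](z; y₀) = ∫_1^∞ s^m Dφ(sz + y₀) ds` (`z ≠ 0`, `φ ∈ C¹` vanishing off `B̄_R`). [folklore] -/
theorem hasFDerivAt_bogovskiiQ_base (hφ : ContDiff ℝ 1 φ) (hR : ∀ z : E3, R < ‖z‖ → φ z = 0) (m : ℕ) {z : E3}
    (hz : z ≠ 0) (y₀ : E3) :
    HasFDerivAt (fun y ↦ bogovskiiQ φ y m z) (∫ s in Ioi (1 : ℝ), (s ^ m) • fderiv ℝ φ (s • z + y₀)) y₀ := by
  have hφc : Continuous φ := hφ.continuous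
  have hdc : Continuous (fderiv ℝ φ) := hφ.continuous_fderiv one_ne_zero
  obtain ⟨M', hM'⟩ := hdc.bounded_above_of_compact_support ((HasCompactSupport.intro (isCompact_closedBall (0 : E3) R)
    fun z hz ↦ hR z (by rwa [mem_closedBall, dist_zero_right, not_le] at hz)).fderiv (𝕜 := ℝ))
  have hM'0 : 0 ≤ M' := (norm_nonneg _).trans (hM' 0)
  have hn : 0 < ‖z‖ := norm_pos_iff.2 hz
  -- on the unit ball around `y₀` the `s`-support is uniformly bounded
  set S₀ : ℝ := max (R + ‖y₀‖ + 1) 0 / ‖z‖ with hS₀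
  have hS₀0 : 0 ≤ S₀ := div_nonneg (le_max_right _ _) hn.le
  have hvan : ∀ y ∈ ball y₀ 1, ∀ s : ℝ, S₀ < |s| → R + ‖y‖ < |s| * ‖z‖ := by
    intro y hy s hs
    rw [mem_ball, dist_eq_norm] at hy
    have hy' : ‖y‖ ≤ ‖y₀‖ + 1 := by
      have := norm_sub_norm_le y y₀; linarith
    rw [hS₀, div_lt_iff₀ hn] at hs
    calc R + ‖y‖ ≤ max (R + ‖y₀‖ + 1) 0 := by
          exact le_trans (by linarith) (le_max_left _ _)
      _ < |s| * ‖z‖ := hs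
  set F : E3 → ℝ → ℝ := fun y s ↦ φ (s • z + y) * s ^ m with hF
  set F' : E3 → ℝ → (E3 →L[ℝ] ℝ) := fun y s ↦ (s ^ m) • fderiv ℝ φ (s • z + y) with hF'
  have hFc : ∀ y, Continuous (F y) := fun y ↦
    (hφc.comp ((continuous_id.smul continuous_const).add continuous_const)).mul (continuous_pow m)
  have hF'c : ∀ y, Continuous (F' y) := fun y ↦
    (continuous_pow m).smul (hdc.comp ((continuous_id.smul continuous_const).add continuous_const))
  have hF_meas : ∀ᶠ y in 𝓝 y₀, AEStronglyMeasurable (F y) (volume.restrict (Ioi 1)) :=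
    Eventually.of_forall fun y ↦ (hFc y).aestronglyMeasurable
  have hF_int : Integrable (F y₀) (volume.restrict (Ioi 1)) := by
    refine ((hFc y₀).integrable_of_hasCompactSupport (HasCompactSupport.intro (isCompact_Icc (a := -S₀) (b := S₀))
      fun s hs ↦ ?_)).restrict
    have hs' : S₀ < |s| := by
      by_contra hle
      exact hs (abs_le.1 (not_lt.1 hle))
    show φ (s • z + y₀) * s ^ m = 0
    rw [eta_ray_eq_zero hR (hvan y₀ (mem_ball_self one_pos) s hs'), zero_mul]
  have hF'_meas : AEStronglyMeasurable (F' y₀) (volume.restrict (Ioi 1)) := (hF'c y₀).aestronglyMeasurable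
  have h_bound : ∀ᵐ s ∂(volume.restrict (Ioi 1)), ∀ y ∈ ball y₀ 1, ‖F' y s‖ ≤
      (Icc (-S₀) S₀).indicator (fun _ ↦ M' * S₀ ^ m) s := by
    refine ae_of_all _ fun s y hy ↦ ?_
    by_cases hs : s ∈ Icc (-S₀) S₀
    · rw [indicator_of_mem hs, hF', norm_smul, Real.norm_eq_abs, abs_pow, mul_comm]
      exact mul_le_mul (hM' _) (pow_le_pow_left₀ (abs_nonneg s) (abs_le.2 ⟨hs.1, hs.2⟩) m) (by positivity) hM'0
    · rw [indicator_of_notMem hs]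
      have hs' : S₀ < |s| := by
        by_contra hle
        exact hs (abs_le.1 (not_lt.1 hle))
      simp only [hF']
      rw [fderiv_eta_ray_eq_zero hR (hvan y hy s hs'), smul_zero, norm_zero]
  have hbi : Integrable (fun s : ℝ ↦ (Icc (-S₀) S₀).indicator (fun _ ↦ M' * S₀ ^ m) s) (volume.restrict (Ioi 1)) :=
    ((integrable_indicator_iff measurableSet_Icc).2 continuous_const.integrableOn_Icc).restrict
  have h_diff : ∀ᵐ s ∂(volume.restrict (Ioi 1)), ∀ y ∈ ball y₀ 1, HasFDerivAt (F · s) (F' y s) y := by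
    refine ae_of_all _ fun s y _ ↦ ?_
    have h1 : HasFDerivAt (fun y : E3 ↦ s • z + y) (ContinuousLinearMap.id ℝ E3) y := (hasFDerivAt_id y).const_add _
    have h2 : HasFDerivAt φ (fderiv ℝ φ (s • z + y)) (s • z + y) := (hφ.differentiable one_ne_zero _).hasFDerivAt
    have h3 := (h2.comp y h1).mul_const (s ^ m)
    have heq : (s ^ m) • (fderiv ℝ φ (s • z + y)).comp (ContinuousLinearMap.id ℝ E3) = F' y s := by
      ext v; simp [hF']
    rw [← heq]
    simpa only [Function.comp_def] using h3
  exact hasFDerivAt_integral_of_dominated_of_fderiv_le (ball_mem_nhds y₀ one_pos) hF_meas hF_int hF'_meas h_bound hbi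
    h_diff

/-- **Base-point derivative rule** `∂_{y,v} Q_m[φ](z; y) = Q_m[∂_v φ](z; y)` (`z ≠ 0`, `φ ∈ C¹`). [folklore] -/
theorem fderiv_bogovskiiQ_base_apply (hφ : ContDiff ℝ 1 φ) (hR : ∀ z : E3, R < ‖z‖ → φ z = 0) (m : ℕ) {z : E3}
    (hz : z ≠ 0) (y : E3) (v : E3) :
    fderiv ℝ (fun y ↦ bogovskiiQ φ y m z) y v = bogovskiiQ (fun w ↦ fderiv ℝ φ w v) y m z := by
  rw [(hasFDerivAt_bogovskiiQ_base hφ hR m hz y).fderiv, bogovskiiQ_apply,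
    ContinuousLinearMap.integral_apply (integrable_pow_smul_fderiv_ray' hφ hR y m hz) v]
  refine integral_congr_ae (ae_of_all _ fun s ↦ ?_)
  simp only [FunLike.coe_smul, Pi.smul_apply, smul_eq_mul]
  ring

/-- Coordinate form: `∂_{y_a} Q_m[φ](z; y) = Q_m[∂_a φ](z; y)`. [folklore] -/
theorem fderiv_bogovskiiQ_base_e (hφ : ContDiff ℝ 1 φ) (hR : ∀ z : E3, R < ‖z‖ → φ z = 0) (m : ℕ) {z : E3}
    (hz : z ≠ 0) (y : E3) (a : Fin 3) :
    fderiv ℝ (fun y ↦ bogovskiiQ φ y m z) y (e a) = bogovskiiQ (pd a φ) y m z :=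
  fderiv_bogovskiiQ_base_apply hφ hR m hz y (e a)

/-- `Q_m[φ](z; ·)` is differentiable in the base point. [folklore] -/
theorem differentiableAt_bogovskiiQ_base (hφ : ContDiff ℝ 1 φ) (hR : ∀ z : E3, R < ‖z‖ → φ z = 0) (m : ℕ) {z : E3}
    (hz : z ≠ 0) (y : E3) : DifferentiableAt ℝ (fun y ↦ bogovskiiQ φ y m z) y :=
  (hasFDerivAt_bogovskiiQ_base hφ hR m hz y).differentiableAt

/-- Symmetry of third partials: `∂_a∂_b∂_c φ = ∂_b∂_c∂_a φ` for `φ ∈ C³`. [folklore] -/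
theorem pd_pd_pd_rotate (hφ : ContDiff ℝ 3 φ) (a b c : Fin 3) : pd a (pd b (pd c φ)) = pd b (pd c (pd a φ)) := by
  have h2 : ContDiff ℝ 2 φ := hφ.of_le (by norm_cast)
  have hc2 : ContDiff ℝ 2 (pd c φ) := contDiff_pd (n := 2) hφ c
  have hac : pd a (pd c φ) = pd c (pd a φ) := funext fun x ↦ pd_pd_comm h2.contDiffAt a c
  funext x
  rw [pd_pd_comm hc2.contDiffAt a b]
  show pd b (pd a (pd c φ)) x = pd b (pd c (pd a φ)) x
  rw [hac]


section Primitive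

variable {η : E3 → ℝ} {R : ℝ}

/-- **Size of the first derivative of the classical kernel** (the degree `−2` primitive of `K₂`): for `η ∈ C¹` with
`|η|, |∂η| ≤ M` vanishing off `B̄_R`, `|y| ≤ ρ`, `z ≠ 0`: `|∂_kΨ(z)| ≤ M(4D³ + 2D⁴)/|z|²`. [cite: MaoOhTao2023, Lemma 2.3] -/
theorem abs_pd_classicalKernel_le (hη : ContDiff ℝ 1 η) (hR : ∀ z : E3, R < ‖z‖ → η z = 0) {M : ℝ}
    (hM0 : ∀ w, |η w| ≤ M) (hM1 : ∀ a w, |pd a η w| ≤ M) {ρ : ℝ} {y : E3} (hy : ‖y‖ ≤ ρ) (i j k : Fin 3) {z : E3}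
    (hz : z ≠ 0) :
    |pd k (fun z : E3 ↦ z i * z j * bogovskiiQ η y 2 z) z| ≤
      M * (4 * (max (R + ρ) 0) ^ 3 + 2 * (max (R + ρ) 0) ^ 4) / ‖z‖ ^ 2 := by
  have hn : 0 < ‖z‖ := norm_pos_iff.2 hz
  have hMnn : 0 ≤ M := (abs_nonneg _).trans (hM0 0)
  set D : ℝ := max (R + ρ) 0 with hD
  have hD0 : 0 ≤ D := le_max_right _ _
  obtain ⟨hkη, hRk⟩ := contDiff_pd_and_vanish (n := 0) hη hR k
  rw [pd_classicalKernel_eq hη hR y i j k hz]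
  have bQ2 : |bogovskiiQ η y 2 z| ≤ 2 * M * D ^ 3 / ‖z‖ ^ 3 := abs_bogovskiiQ_le_of_norm_le hη.continuous hR hM0 hy 2 hz
  have bQ3 : |bogovskiiQ (pd k η) y 3 z| ≤ 2 * M * D ^ 4 / ‖z‖ ^ 4 :=
    abs_bogovskiiQ_le_of_norm_le hkη.continuous hRk (hM1 k) hy 3 hz
  have bL := abs_delta_coord_add_le i j k z
  have bij : |z i * z j| ≤ ‖z‖ ^ 2 := by
    rw [abs_mul, sq]
    have hi : |z i| ≤ ‖z‖ := by simpa using PiLp.norm_apply_le z i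
    have hj : |z j| ≤ ‖z‖ := by simpa using PiLp.norm_apply_le z j
    exact mul_le_mul hi hj (abs_nonneg _) (norm_nonneg _)
  calc _ ≤ |((if i = k then (1 : ℝ) else 0) * z j + (if j = k then 1 else 0) * z i) * bogovskiiQ η y 2 z| +
        |z i * z j * bogovskiiQ (pd k η) y 3 z| := abs_add_le _ _
    _ ≤ 2 * ‖z‖ * (2 * M * D ^ 3 / ‖z‖ ^ 3) + ‖z‖ ^ 2 * (2 * M * D ^ 4 / ‖z‖ ^ 4) := by
        rw [abs_mul, abs_mul (z i * z j)]
        exact add_le_add (mul_le_mul bL bQ2 (abs_nonneg _) (by positivity))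
          (mul_le_mul bij bQ3 (abs_nonneg _) (by positivity))
    _ = M * (4 * D ^ 3 + 2 * D ^ 4) / ‖z‖ ^ 2 := by field_simp; ring

/-- The first derivative `∂_kΨ` of the classical kernel is differentiable off the origin (for `η ∈ C²`), with
`D(∂_kΨ)(z) e_l = K₂(z)`. [folklore] -/
theorem differentiableAt_pd_classicalKernel (hη : ContDiff ℝ 2 η) (hR : ∀ z : E3, R < ‖z‖ → η z = 0) (y : E3)
    (i j k : Fin 3) {z : E3} (hz : z ≠ 0) :
    DifferentiableAt ℝ (pd k (fun z : E3 ↦ z i * z j * bogovskiiQ η y 2 z)) z := by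
  have h1 : ContDiff ℝ 1 η := hη.of_le (by norm_cast)
  obtain ⟨hkη, hRk⟩ := contDiff_pd_and_vanish (n := 1) hη hR k
  have hev : pd k (fun z : E3 ↦ z i * z j * bogovskiiQ η y 2 z) =ᶠ[𝓝 z] fun z ↦
      ((if i = k then 1 else 0) * z j + (if j = k then 1 else 0) * z i) * bogovskiiQ η y 2 z +
        z i * z j * bogovskiiQ (pd k η) y 3 z := by
    filter_upwards [isOpen_compl_singleton.mem_nhds hz] with w hw
    exact pd_classicalKernel_eq h1 hR y i j k hw
  refine DifferentiableAt.congr_of_eventuallyEq ?_ hev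
  have hQ2 := differentiableAt_bogovskiiQ h1 hR y 2 hz
  have hQ3 := differentiableAt_bogovskiiQ hkη hRk y 3 hz
  have hzi : DifferentiableAt ℝ (fun z : E3 ↦ z i) z := (EuclideanSpace.proj (𝕜 := ℝ) i).differentiableAt
  have hzj : DifferentiableAt ℝ (fun z : E3 ↦ z j) z := (EuclideanSpace.proj (𝕜 := ℝ) j).differentiableAt
  fun_prop

/-- `D(∂_kΨ)(z) e_l = K₂(z)` off the origin. [cite: MaoOhTao2023, Lemma 2.3] -/
theorem fderiv_pd_classicalKernel_apply_e (hη : ContDiff ℝ 2 η) (hR : ∀ z : E3, R < ‖z‖ → η z = 0) (y : E3)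
    (i j k l : Fin 3) {z : E3} (hz : z ≠ 0) :
    fderiv ℝ (pd k (fun z : E3 ↦ z i * z j * bogovskiiQ η y 2 z)) z (e l) = bogovskiiK2 η y i j k l z :=
  pd_pd_classicalKernel_eq_bogovskiiK2 hη hR y i j k l hz

end Primitive

section SmoothOffOrigin

variable {η φ : E3 → ℝ} {R : ℝ}

/-- `Q_m[φ]` is `C¹` off the origin (for `φ ∈ C²`). [folklore] -/
theorem contDiffOn_bogovskiiQ (hφ : ContDiff ℝ 2 φ) (hR : ∀ z : E3, R < ‖z‖ → φ z = 0) (y : E3) (m : ℕ) :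
    ContDiffOn ℝ 1 (bogovskiiQ φ y m) {0}ᶜ := by
  have h1 : ContDiff ℝ 1 φ := hφ.of_le (by norm_cast)
  rw [show (1 : WithTop ℕ∞) = 0 + 1 from rfl, contDiffOn_succ_iff_fderiv_of_isOpen isOpen_compl_singleton]
  refine ⟨fun z hz ↦ (differentiableAt_bogovskiiQ h1 hR y m hz).differentiableWithinAt, by simp, ?_⟩
  exact contDiffOn_zero.2 (continuousOn_fderiv_bogovskiiQ hφ hR y m)

/-- **`K₂` is `C¹` off the origin** (for `η ∈ C⁴`). [folklore] -/
theorem contDiffOn_bogovskiiK2 (hη : ContDiff ℝ 4 η) (hR : ∀ z : E3, R < ‖z‖ → η z = 0) (y : E3) (i j k l : Fin 3) :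
    ContDiffOn ℝ 1 (bogovskiiK2 η y i j k l) {0}ᶜ := by
  have h2 : ContDiff ℝ 2 η := hη.of_le (by norm_cast)
  obtain ⟨hkη, hRk⟩ := contDiff_pd_and_vanish (n := 3) hη hR k
  obtain ⟨hlη, hRl⟩ := contDiff_pd_and_vanish (n := 3) hη hR l
  obtain ⟨hlkη, hRlk⟩ := contDiff_pd_and_vanish (n := 2) hkη hRk l
  have hQ2 := contDiffOn_bogovskiiQ h2 hR y 2
  have hQ3l := contDiffOn_bogovskiiQ (hlη.of_le (by norm_cast)) hRl y 3
  have hQ3k := contDiffOn_bogovskiiQ (hkη.of_le (by norm_cast)) hRk y 3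
  have hQ4 := contDiffOn_bogovskiiQ hlkη hRlk y 4
  have hzi : ContDiff ℝ 1 (fun z : E3 ↦ z i) := (EuclideanSpace.proj (𝕜 := ℝ) i).contDiff
  have hzj : ContDiff ℝ 1 (fun z : E3 ↦ z j) := (EuclideanSpace.proj (𝕜 := ℝ) j).contDiff
  have hL1 : ContDiff ℝ 1 (fun z : E3 ↦ (if i = k then (1 : ℝ) else 0) * z j + (if j = k then 1 else 0) * z i) :=
    (contDiff_const.mul hzj).add (contDiff_const.mul hzi)
  have hL2 : ContDiff ℝ 1 (fun z : E3 ↦ (if i = l then (1 : ℝ) else 0) * z j + (if j = l then 1 else 0) * z i) :=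
    (contDiff_const.mul hzj).add (contDiff_const.mul hzi)
  unfold bogovskiiK2
  exact (((contDiffOn_const.mul hQ2).add (hL1.contDiffOn.mul hQ3l)).add (hL2.contDiffOn.mul hQ3k)).add
    ((hzi.mul hzj).contDiffOn.mul hQ4)

end SmoothOffOrigin

section BaseDerivative

variable {η : E3 → ℝ} {R : ℝ}

/-- **Base-point derivative of the frozen kernel**: `∂_{y_a} K₂[η](z; y) = K₂[∂_aη](z; y)` (`η ∈ C³`, `z ≠ 0`): the
base-point derivative is the kernel of the same type with `η` replaced by `∂_aη`. [cite: MaoOhTao2023, Lemma 2.3] -/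
theorem hasFDerivAt_bogovskiiK2_base (hη : ContDiff ℝ 3 η) (hR : ∀ z : E3, R < ‖z‖ → η z = 0) (i j k l : Fin 3)
    {z : E3} (hz : z ≠ 0) (y : E3) :
    DifferentiableAt ℝ (fun y ↦ bogovskiiK2 η y i j k l z) y ∧
      ∀ a : Fin 3, fderiv ℝ (fun y ↦ bogovskiiK2 η y i j k l z) y (e a) = bogovskiiK2 (pd a η) y i j k l z := by
  have h1 : ContDiff ℝ 1 η := hη.of_le (by norm_cast)
  have h2 : ContDiff ℝ 2 η := hη.of_le (by norm_cast)
  obtain ⟨hkη, hRk⟩ := contDiff_pd_and_vanish (n := 2) hη hR k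
  obtain ⟨hlη, hRl⟩ := contDiff_pd_and_vanish (n := 2) hη hR l
  obtain ⟨hlkη, hRlk⟩ := contDiff_pd_and_vanish (n := 1) hkη hRk l
  have hkη1 : ContDiff ℝ 1 (pd k η) := hkη.of_le (by norm_cast)
  have hlη1 : ContDiff ℝ 1 (pd l η) := hlη.of_le (by norm_cast)
  have dQ2 := differentiableAt_bogovskiiQ_base h1 hR 2 hz y
  have dQ3l := differentiableAt_bogovskiiQ_base hlη1 hRl 3 hz y
  have dQ3k := differentiableAt_bogovskiiQ_base hkη1 hRk 3 hz y
  have dQ4 := differentiableAt_bogovskiiQ_base hlkη hRlk 4 hz y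
  have dT1 : DifferentiableAt ℝ (fun y ↦ ((if i = k then (1 : ℝ) else 0) * (if j = l then 1 else 0) +
      (if j = k then 1 else 0) * (if i = l then 1 else 0)) * bogovskiiQ η y 2 z) y := dQ2.const_mul _
  have dT2 : DifferentiableAt ℝ (fun y ↦ ((if i = k then (1 : ℝ) else 0) * z j + (if j = k then 1 else 0) * z i) *
      bogovskiiQ (pd l η) y 3 z) y := dQ3l.const_mul _
  have dT3 : DifferentiableAt ℝ (fun y ↦ ((if i = l then (1 : ℝ) else 0) * z j + (if j = l then 1 else 0) * z i) *
      bogovskiiQ (pd k η) y 3 z) y := dQ3k.const_mul _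
  have dT4 : DifferentiableAt ℝ (fun y ↦ z i * z j * bogovskiiQ (pd l (pd k η)) y 4 z) y := dQ4.const_mul _
  have dT12 : DifferentiableAt ℝ (fun y ↦ ((if i = k then (1 : ℝ) else 0) * (if j = l then 1 else 0) +
      (if j = k then 1 else 0) * (if i = l then 1 else 0)) * bogovskiiQ η y 2 z +
      ((if i = k then (1 : ℝ) else 0) * z j + (if j = k then 1 else 0) * z i) * bogovskiiQ (pd l η) y 3 z) y :=
    dT1.add dT2
  have dT123 : DifferentiableAt ℝ (fun y ↦ ((if i = k then (1 : ℝ) else 0) * (if j = l then 1 else 0) +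
      (if j = k then 1 else 0) * (if i = l then 1 else 0)) * bogovskiiQ η y 2 z +
      ((if i = k then (1 : ℝ) else 0) * z j + (if j = k then 1 else 0) * z i) * bogovskiiQ (pd l η) y 3 z +
      ((if i = l then (1 : ℝ) else 0) * z j + (if j = l then 1 else 0) * z i) * bogovskiiQ (pd k η) y 3 z) y :=
    dT12.add dT3
  have hK : (fun y ↦ bogovskiiK2 η y i j k l z) = fun y ↦ ((if i = k then (1 : ℝ) else 0) * (if j = l then 1 else 0) +
      (if j = k then 1 else 0) * (if i = l then 1 else 0)) * bogovskiiQ η y 2 z +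
      ((if i = k then (1 : ℝ) else 0) * z j + (if j = k then 1 else 0) * z i) * bogovskiiQ (pd l η) y 3 z +
      ((if i = l then (1 : ℝ) else 0) * z j + (if j = l then 1 else 0) * z i) * bogovskiiQ (pd k η) y 3 z +
      z i * z j * bogovskiiQ (pd l (pd k η)) y 4 z := rfl
  refine ⟨by rw [hK]; exact dT123.add dT4, fun a ↦ ?_⟩
  rw [hK, fderiv_fun_add dT123 dT4, fderiv_fun_add dT12 dT3, fderiv_fun_add dT1 dT2, fderiv_const_mul dQ2,
    fderiv_const_mul dQ3l, fderiv_const_mul dQ3k, fderiv_const_mul dQ4]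
  simp only [_root_.add_apply, _root_.smul_apply, smul_eq_mul]
  rw [fderiv_bogovskiiQ_base_e h1 hR 2 hz y a, fderiv_bogovskiiQ_base_e hlη1 hRl 3 hz y a,
    fderiv_bogovskiiQ_base_e hkη1 hRk 3 hz y a, fderiv_bogovskiiQ_base_e hlkη hRlk 4 hz y a]
  -- commute the partials back into the `K₂[∂_aη]` normal form
  have c1 : pd a (pd l η) = pd l (pd a η) := funext fun x ↦ pd_pd_comm h2.contDiffAt a l
  have c2 : pd a (pd k η) = pd k (pd a η) := funext fun x ↦ pd_pd_comm h2.contDiffAt a k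
  have c3 : pd a (pd l (pd k η)) = pd l (pd k (pd a η)) := pd_pd_pd_rotate hη a l k
  rw [c1, c2, c3]
  rfl

/-- **Norm of the base-point derivative**: for `η ∈ C³` with `|∂η|, |∂²η|, |∂³η| ≤ M`, `|y| ≤ ρ`, `z ≠ 0`,
`‖D_y K₂[η](z; y)‖ ≤ 3M(4D³ + 8D⁴ + 2D⁵)/|z|³`. [cite: MaoOhTao2023, Lemma 2.3 (S3)] -/
theorem norm_fderiv_bogovskiiK2_base_le (hη : ContDiff ℝ 3 η) (hR : ∀ z : E3, R < ‖z‖ → η z = 0) {M : ℝ}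
    (hM1 : ∀ a w, |pd a η w| ≤ M) (hM2 : ∀ a b w, |pd a (pd b η) w| ≤ M)
    (hM3 : ∀ a b c w, |pd a (pd b (pd c η)) w| ≤ M) {ρ : ℝ} {y : E3} (hy : ‖y‖ ≤ ρ) (i j k l : Fin 3) {z : E3}
    (hz : z ≠ 0) :
    ‖fderiv ℝ (fun y ↦ bogovskiiK2 η y i j k l z) y‖ ≤
      3 * (M * (4 * (max (R + ρ) 0) ^ 3 + 8 * (max (R + ρ) 0) ^ 4 + 2 * (max (R + ρ) 0) ^ 5) / ‖z‖ ^ 3) := by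
  have h2 : ContDiff ℝ 2 η := hη.of_le (by norm_cast)
  refine (norm_fderiv_le_sum_abs_pd _ y).trans ?_
  calc ∑ a, |pd a (fun y ↦ bogovskiiK2 η y i j k l z) y|
      ≤ ∑ _a : Fin 3, M * (4 * (max (R + ρ) 0) ^ 3 + 8 * (max (R + ρ) 0) ^ 4 + 2 * (max (R + ρ) 0) ^ 5) / ‖z‖ ^ 3 := by
        refine Finset.sum_le_sum fun a _ ↦ ?_
        rw [pd, (hasFDerivAt_bogovskiiK2_base hη hR i j k l hz y).2 a]
        obtain ⟨haη, hRa⟩ := contDiff_pd_and_vanish (n := 2) hη hR a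
        exact abs_bogovskiiK2_le haη hRa (hM1 a) (fun b w ↦ hM2 b a w) (fun b c w ↦ hM3 b c a w) hy i j k l hz
    _ = _ := by simp [Finset.sum_const, Finset.card_univ, Fintype.card_fin]

end BaseDerivative

end MaoOhTao

end Literature.Geometry.Lorentzian
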